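import Summits.HodgeConjecture.HodgeConjecture.Theses.PadicSemiregularLift
import Summits.HodgeConjecture.HodgeConjecture.Theorems.HodgeFermatVarieties.Negative.DegreeZeroVacuous
import Literature.AlgebraicGeometry.HodgeTheory.FermatInductiveClaims
import Literature.AlgebraicGeometry.HodgeTheory.SupportedHodgeClassesAlgebraic

/-!
# Line `odd-coniveau-calculus` — skeleton for crux `HodgeFermatVarieties` (stmt-HodgeConjecture-1334)

Route `PadicSemiregularLift`, crux `HodgeFermatVarieties` (rank-5 OUTPUT item: the Hodge conjecture for
every complex Fermat hypersurface `Xⁿₘ : x₀ᵐ + ⋯ + x_{n+1}ᵐ = 0`, all `n`, all `m`). Idea card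
`Cruxes/HodgeFermatVarieties/Ideas/odd-coniveau-calculus.md` (ideator 1; triage r1-1/2/3: pass ×3).

THE LINE. Read HC for the EVEN Fermat varieties one coniveau step lower and feed it from the ODD ones.
For a Hodge character `α ∈ 𝔅` of `X²ᵖ⁺²ₘ` (middle degree `2p+2`, `2p+4` coordinates) it suffices —
by Voisin's form of Lefschetz `(1,1)` + semisimplicity + Gysin (`stub_submaximalConiveau`: a RATIONAL
`(p+1,p+1)`-class in `Nᵖ H²ᵖ⁺²` is algebraic) and the eigenspace structure of `Hⁿ(Xⁿₘ)` (Ran Prop. 1.7,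
`stub_eigenspaceStructure`) — that EVERY Hodge eigenline `V(α)` lie in `Nᵖ H²ᵖ⁺²(X²ᵖ⁺²ₘ)`
(SUBMAXIMAL coniveau; proved here: `middleDegree_of_submax`). The parity-graded claim calculus of the
card supplies exactly that from level-one pieces of ODD Fermat varieties, by Shioda's inductive
structure read on SUPPORTS (da Silva Thm. 2.2 = Shioda 1979 Thm. I / Shioda–Katsura 1979, with
Arapura–Kang functoriality of the coniveau filtration under the correspondences):
* (R2, `stub_joinConiveau`, type II = Ran's ruled join `∗`) `V(β) ⊆ N^{k₁}H^{2k₁+1}(X^{2k₁+1}ₘ)`,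
  `V(γ) ⊆ N^{k₂}H^{2k₂+1}(X^{2k₂+1}ₘ)` ⟹ `V(β∗γ) ⊆ N^{k₁+k₂+1}H^{2(k₁+k₂+2)}` — the join of two classes
  of maximal coniveau is a class of submaximal coniveau;
* (R1/θ, `stub_mergeConiveau`, type I = Shioda–Katsura's blow-up `X^{2p+1}ₘ × X¹ₘ ⇢ X^{2p+2}ₘ`, i.e.
  Ran's `θ`: MERGE two coordinates) if the odd character obtained from `α` by merging `αᵢ, αⱼ`
  (`αᵢ + αⱼ ≠ 0`) into one coordinate has eigenline of maximal coniveau `p` on `X^{2p+1}ₘ`, then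
  `V(α) ⊆ Nᵖ H^{2p+2}(X^{2p+2}ₘ)`;
* (ENGINE, `stub_oddLevelOneConiveau`, OPEN) every LEVEL-ONE eigenline of an odd Fermat variety has
  maximal coniveau: `β` admissible on `X^{2k+1}ₘ` with `|tβ| ∈ {k+1, k+2}` for all units `t` ⟹
  `V(β) ⊆ Nᵏ H^{2k+1}(X^{2k+1}ₘ)` — Grothendieck's amended GHC in Hodge level one for odd Fermat
  hypersurfaces = Ran 1980's programme (Thm. 3.16 for `k = 1`, Thm. 4.11) WITHOUT its arithmetic
  provisos `(1.10)ₘ` / `(1.11)ₘ,ₖ` (which fail at the degrees that matter, e.g. `m = 35`).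
The dispatcher `submax_of_isHodge` (PROVED here, sorry-free) routes every Hodge `α`: if `α = β ∗ c`
with `c` an admissible curve character then `β` is level one (`levelOne_of_join`) and (R2) applies
(this is the card's `m = 35` instance verbatim: `(1,2,16,17,21,22,30,31) = (1,21,22,30,31) ∗ (2,16,17)`,
engine instance `V[(1,21,22,30,31)] ⊆ N¹H³(X³₃₅)` = CURVES ON THE FERMAT THREEFOLD); else if some
`αᵢ + αⱼ ≠ 0` the merged character is level one (`levelOne_of_merge`) and (R1/θ) applies; else all
pairs are opposite, `α` is paired and `V(α)` is spanned by linear subspaces (Shioda/Ran/Aoki Thm 1-1,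
vendored fact `Shioda_claim_paired` inside `stub_fermatFacts`). Off the middle degree, Hodge models,
the standard model `V₊(Σxᵢᵐ)`, `m = 0` (vacuous, landed Negative lemma `degree_zero_vacuous`) and
`n = 0` are bookkeeping proved here from the tree.

STUBS (6) and the sorry-free `lineImplication : stub₁ → … → stub₆ → HodgeFermatVarieties`;
`HodgeFermatVarieties_of` is literally `lineImplication stub_fermatFacts … stub_oddLevelOneConiveau`.

Disproof used (`Cruxes/HodgeFermatVarieties/Disproof.lean`, cdisprove cycle 1, v3): §2 — NO
`_false_without_` theorem exists (neither hypothesis of the crux is load-bearing; nothing to honour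
beyond HC itself); §3/landed Negative `Theorems/HodgeFermatVarieties/Negative/DegreeZeroVacuous`
(`degree_zero_vacuous`, IMPORTED and USED in `hodgeFermatVarieties_of_standardModel`); §4
`iff_standardModel` (we attack exactly `StandardModelHC`; its transport `hodgeConjectureFor_of_iso`
is re-proved here since Cruxes files are not importable); §5 `of_facts` (our `stub_fermatFacts`
carries the same Lefschetz/Hodge-model facts; the degree-restricted facts Shioda ≤ 20 / Aoki pᵉ /
da Silva 21, 27 are NOT assumed — the line is uniform in `m`); §6 `not_forall_shiodaCondition*`
(no stub asserts a uniform `(Pₘ)`: the merge/join stubs are TRANSPORT statements, the arithmetic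
input is replaced by the geometric engine). Negatives index: `DerivedTorelliFermatK3Exhaustion_refuted`
(m = 110 sextuples unreachable by printed constructions) — no exhaustion/reachability claim is made;
`ELineConnectivity_refuted` — unrelated. No stub is an instance of a landed Negative lemma.
-/

set_option linter.dupNamespace false

noncomputable section

open CategoryTheory AlgebraicGeometry Finset
open Literature.AlgebraicGeometry Literature.AlgebraicGeometry.Motives Literature.AlgebraicGeometry.HodgeTheory
open Literature.AlgebraicTopology.SingularHomology
open Summit.HodgeConjecture.HodgeConjecture.Theses.PadicSemiregularLift (HodgeFermatVarieties)
open Summit.HodgeConjecture.HodgeConjecture.Theorems.HodgeFermatVarietiesNegative (degree_zero_vacuous)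

namespace Summit.HodgeConjecture.HodgeConjecture.Cruxes.HodgeFermatVarieties.OddConiveauCalculus

/-! ### Local notations of the line -/

/-- `Claim₁[m, k, γ]` — **Aoki's claim one coniveau step up, for the ODD Fermat variety**: the
eigenline `V(γ) ⊆ H^{2k+1}(X^{2k+1}ₘ(ℂ); ℂ)` of a character `γ` (`2k+3` coordinates) is supported in
codimension `k` (lies in `Nᵏ H^{2k+1} = supportedClasses _ (2k+1) k`), the MAXIMAL coniveau a class of
Hodge level one can have ("`V(γ)` has rank `k`" in Ran's language). For `k = 0` (the Fermat curve)
it is automatic (`N⁰ = everything`). Local notation only. -/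
local notation3 (prettyPrint := false) "Claim₁[" m ", " k ", " γ "]" =>
  fermatEigenspace m γ (2 * k + 1) ≤ supportedClasses (fermatHypersurface (2 * k + 1) m) (2 * k + 1) k

/-- `LevelOne[m, k, γ]` — `γ` (a character of `X^{2k+1}ₘ`, `2k+3` coordinates) is ADMISSIBLE (all
`γᵢ ≠ 0`, `Σ γᵢ = 0`) and of HODGE LEVEL ONE: `|tγ| ∈ {k+1, k+2}` for every unit `t`, i.e. the
`ℚ`-Hodge structure `⨁ₜ V(tγ)` has only the Hodge types `(k+1, k)`, `(k, k+1)` (Ran Prop. 1.7 (ii):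
`V(γ) ⊂ H^{|γ|-1, n+1-|γ|}`). Written with `m·|tγ| = normSum (t • γ)`. Local notation only. -/
local notation3 (prettyPrint := false) "LevelOne[" m ", " k ", " γ "]" =>
  (FermatCharacter.IsAdmissible γ ∧ ∀ t : (ZMod m)ˣ,
    FermatCharacter.normSum (fun i ↦ (t : ZMod m) * γ i) = m * (k + 1) ∨
      FermatCharacter.normSum (fun i ↦ (t : ZMod m) * γ i) = m * (k + 2))

/-- `Submax[m, p, α]` — the eigenline `V(α) ⊆ H^{2p+2}(X^{2p+2}ₘ(ℂ); ℂ)` (`α` with `2p+4`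
coordinates) has SUBMAXIMAL coniveau: it lies in `Nᵖ H^{2p+2} = supportedClasses _ (2(p+1)) p` (one step
below algebraic `= N^{p+1}`). Local notation only. -/
local notation3 (prettyPrint := false) "Submax[" m ", " p ", " α "]" =>
  fermatEigenspace m α (2 * (p + 1)) ≤
    supportedClasses (fermatHypersurface (2 * (p + 1)) m) (2 * (p + 1)) p

/-- `EigenStructure` — the `μₘⁿ⁺²`-eigenspace structure of the middle cohomology of `X²ᵖₘ`, `p > 0`,
in the three forms the tree's assembly `mem_algebraicClasses_fermat_middle_of_eigenspaces` consumes
(Ran 1980 Prop. 1.7 (i)–(ii); Shioda 1979 §1): `V(α) ∩ H²ᵖ = 0` for `α ≠ 0` with a zero entry;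
`V(0) ∩ H²ᵖ` is restricted from `ℙ²ᵖ⁺¹`; the `(p,p)` case of the Hodge types of the `V(β)`.
Local notation only. -/
local notation3 (prettyPrint := false) "EigenStructure" =>
  ∀ (p m : ℕ) [NeZero m], 0 < p →
    (∀ α : Fin (2 * p + 2) → ZMod m, α ≠ 0 → (∃ i, α i = 0) → fermatEigenspace m α (2 * p) = ⊥) ∧
    (fermatEigenspace m (0 : Fin (2 * p + 2) → ZMod m) (2 * p) ≤
      LinearMap.range (complexBetti.map
        (SmoothHypersurface.hypersurfaceι (fermatPolynomial ℂ (2 * p) m)) (2 * p)).hom) ∧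
    (∀ (A : HodgeModel (2 * p) (fermatHypersurface (2 * p) m)) (β : Fin (2 * p + 2) → ZMod m),
      (∀ i, β i ≠ 0) →
      (∃ x ∈ fermatEigenspace m β (2 * p), x ≠ 0 ∧ A.pullback (2 * p) x ∈ A.hodgePQ (2 * p) p p) →
        2 * FermatCharacter.normSum β = m * (2 * p + 2))

/-- `SubmaximalConiveau` — on a smooth projective `X/ℂ` a RATIONAL class of Hodge type `(p+1,p+1)`
in `Nᵖ H^{2p+2}(X(ℂ); ℂ)` is algebraic (Voisin 2013, proof of Lemma 2.1; `p = 0` is Lefschetz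
`(1,1)`). Verbatim the text of the (retired) route item
`ConiveauLadderCubicEightfolds.SubmaximalConiveauHodgeClassesAlgebraic` (stmt-1912); PROVED in the
tree modulo five named facts (`supportedHodgeClass_algebraic_of_facts`). Local notation only. -/
local notation3 (prettyPrint := false) "SubmaximalConiveau" =>
  ∀ ⦃n : ℕ⦄ ⦃X : SchemeOver ℂ⦄, IsSmoothProjective n X →
    ∀ (p : ℕ) (c : complexBetti X (2 * (p + 1))), c ∈ supportedClasses X (2 * (p + 1)) p →
      IsRationalClass c → IsOfHodgeType n X (2 * (p + 1)) (p + 1) (p + 1) c →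
        c ∈ algebraicClasses X (p + 1)

/-- `MergeConiveau` — rule (R1/θ) of the calculus (TYPE I on supports): for an admissible `α` on
`X^{2p+2}ₘ` and coordinates `i ≠ j` with `αᵢ + αⱼ ≠ 0`, if the MERGED odd character `β` on
`X^{2p+1}ₘ` (multiset of values `α ∖ {αᵢ, αⱼ} ∪ {αᵢ+αⱼ}`, merged value in the last coordinate —
any indexing) has `Claim₁`, then `V(α)` is submaximal. Local notation only. -/
local notation3 (prettyPrint := false) "MergeConiveau" =>
  ∀ (m p : ℕ) [NeZero m] (α : Fin (2 * (p + 1) + 2) → ZMod m) (i j : Fin (2 * (p + 1) + 2)),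
    i ≠ j → FermatCharacter.IsAdmissible α → α i + α j ≠ 0 →
    (∀ β : Fin (2 * p + 1 + 2) → ZMod m, β (Fin.last _) = α i + α j →
      univ.val.map α + {α i + α j} = univ.val.map β + {α i, α j} → Claim₁[m, p, β]) →
    Submax[m, p, α]

/-- `JoinConiveau` — rule (R2) of the calculus (TYPE II = Ran's ruled join `∗`, on supports): for
admissible odd characters `β` on `X^{2k₁+1}ₘ`, `γ` on `X^{2k₂+1}ₘ` with `Claim₁`, every `α` on
`X^{2(k₁+k₂+2)}ₘ` whose multiset of values is that of `β` plus that of `γ` (`α = β ∗ γ` up to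
permutation) has `V(α)` of submaximal coniveau `k₁ + k₂ + 1`. Local notation only. -/
local notation3 (prettyPrint := false) "JoinConiveau" =>
  ∀ (m k₁ k₂ : ℕ) [NeZero m] (β : Fin (2 * k₁ + 1 + 2) → ZMod m) (γ : Fin (2 * k₂ + 1 + 2) → ZMod m)
    (α : Fin (2 * (k₁ + k₂ + 1 + 1) + 2) → ZMod m),
    FermatCharacter.IsAdmissible β → FermatCharacter.IsAdmissible γ →
    univ.val.map α = univ.val.map β + univ.val.map γ →
    Claim₁[m, k₁, β] → Claim₁[m, k₂, γ] → Submax[m, k₁ + k₂ + 1, α]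

/-- `OddLevelOneGHC` — THE ENGINE: every level-one eigenline of an odd Fermat variety has maximal
coniveau. Local notation only. -/
local notation3 (prettyPrint := false) "OddLevelOneGHC" =>
  ∀ (m k : ℕ) [NeZero m] (γ : Fin (2 * k + 1 + 2) → ZMod m), LevelOne[m, k, γ] → Claim₁[m, k, γ]

/-! ### The registered stubs -/

/-- **Stub 1 — the vendored Fermat/Hodge package** (three NAMED FACTS of the tree, research risk nil;
each conjunct closes when discharged in `Literature`): (i) `Voisin2003_smoothHypersurface_algebraicClasses_eq_top`
(`HodgeTheory/HypersurfaceLefschetz`; Voisin II Thm 1.23, Cor 1.24–1.25): off the middle degree every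
class of a smooth hypersurface is algebraic; (ii) `nonempty_hodgeModel` (`HodgeTheory/HodgeModelExistence`;
GAGA + de Rham + Hodge decomposition): smooth projective complex varieties have Hodge models — the
anti-vacuity conjunct of `HodgeConjectureFor`; (iii) `Shioda_claim_paired` (`HodgeTheory/FermatInductiveClaims`;
Aoki 1987 Thm 1-1 = Shioda / Ran 1980 Thm 4.9): the eigenline of a PAIRED character is spanned by
classes of linear subspaces `x_i = ε x_{σ i}` — used only for the totally opposite characters
`(a, …, a)`, `2a = 0`, the one shape the calculus does not split. Size XL (formalisation), risk nil. -/
theorem stub_fermatFacts :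
    Voisin2003_smoothHypersurface_algebraicClasses_eq_top ∧
      (∀ (n : ℕ) (X : SchemeOver ℂ), nonempty_hodgeModel n X) ∧ Shioda_claim_paired := by
  sorry

/-- **Stub 2 — the eigenspace structure of `H²ᵖ(X²ᵖₘ(ℂ); ℂ)` under `μₘ²ᵖ⁺²`** (Ran 1980 Prop. 1.7
(i)–(ii); Shioda 1979 Math. Ann. §1 (1.7) `V(α) ⊂ H^{|α|-1, n+1-|α|}`, `Hⁿ(Xⁿₘ)^{Gⁿₘ} = ℂ·hᵖ`): exactly
the three hypotheses `hE2`, `hE0`, `hE4` of the tree's `mem_algebraicClasses_fermat_middle_of_eigenspaces`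
/ `hodgeClasses_algebraic_fermat_of_eigenspaces`, for ALL `m ≥ 1` and `p > 0` (the tree asks them only
for `m` prime or `≤ 20`; the statements do not depend on that). In print: Pham–Brieskorn basis of the
affine Fermat hypersurface / Griffiths residues (tree: `FermatAffineChart`, in progress). Theorem in
print; size L–XL; research risk nil. -/
theorem stub_eigenspaceStructure : EigenStructure := by
  sorry

/-- **Stub 3 — rational Hodge classes of submaximal coniveau are algebraic** (Voisin, Ann. Sci. ÉNS 46
(2013), proof of Lemma 2.1 with `k = p + 1`; Grothendieck 1969 p. 300; Deligne Hodge III Cor. 8.2.8;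
semisimplicity; Lefschetz `(1,1)`): on `X` smooth projective of dimension `n`, a rational
`(p+1, p+1)`-class `c ∈ Nᵖ H^{2p+2}(X(ℂ); ℂ)` lies in `algebraicClasses X (p+1) = N^{p+1}H^{2p+2}`.
PROVED in the tree from five named facts (`supportedHodgeClass_algebraic_of_facts hA hB hS hH hL μ hμ`
in `HodgeTheory/SupportedHodgeClassesAlgebraic`: Deligne's kernel description, Hodge-class lifting
along Gysin surjections, Gysin/restriction compatibility (itself PROVED: `gysinMap_restrictCompl_eq_zero_of_field`),
projective Hironaka, `lefschetzOneOne_rational`; orientation family from `ComplexPoints.isOrientableOver`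
with `OrientationFamily.hasPoincareDuality`). This is the step "(R2) … a Hodge class of coniveau
`p − 1` is algebraic" of the card, applied once, to the RATIONAL class `c = Σ_α π_α c` (never to a
single complex eigenline). Size M (given the facts), research risk nil. -/
theorem stub_submaximalConiveau : SubmaximalConiveau := by
  sorry

/-- **Stub 4 — (R1/θ) MERGE: Shioda's type-I inductive structure respects coniveau.** For `m ≥ 1`,
an admissible `α = (α₀, …, α_{2p+3})` on `X^{2p+2}ₘ` and `i ≠ j` with `αᵢ + αⱼ ≠ 0`: if every
character `β` of `X^{2p+1}ₘ` realising the MERGE of the coordinates `i, j` (`β_last = αᵢ + αⱼ`,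
`{α} + {αᵢ+αⱼ} = {β} + {αᵢ, αⱼ}` as multisets of values) has `V(β) ⊆ Nᵖ H^{2p+1}(X^{2p+1}ₘ)`, then
`V(α) ⊆ Nᵖ H^{2p+2}(X^{2p+2}ₘ)`. Proof route: `α ∼ β # c` with `c = (αᵢ, αⱼ, -αᵢ-αⱼ)` a character
of the Fermat CURVE; Shioda–Katsura's degree-`m` correspondence `Z = Bl(X^{2p+1}ₘ × X¹ₘ) → X^{2p+2}ₘ`
induces da Silva Thm 2.2's `f` on the first summand, `G`-equivariant of type `(0,0)`, carrying
`V(β) ⊗ V(c)` onto `V(β # c)`; a class supported on `W ⊂ X^{2p+1}ₘ` of codimension `p` gives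
`pr₁^*`-, blow-up- and `φ_*`-images supported in codimension `≥ p` (dimension count: `dim W × X¹ =
p + 2`, exceptional part `≤ p + 2`, inside the `(2p+2)`-fold), i.e. correspondences preserve the
coniveau filtration (Arapura–Kang, Canad. Math. Bull. 50 (2007), doi:10.4153/cmb-2007-017-5;
Bloch–Ogus); coordinate permutations are automorphisms preserving `supportedClasses` (tree:
`FermatClaimPermutationInvariance` pattern). This is Ran's `θ_k` "preserves rank" (Prop. 3.15) in
Shioda–Katsura form. Why it might fail: only through a gap in the isotypic identification for odd
`r, s` (printed: Shioda Math. Ann. 245 Thm I; da Silva Thm 2.2 (b)); formal debt: the blow-up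
correspondence as a smooth projective `ℂ`-scheme + Künneth on the real carriers (shared with the
tree's open `Aoki1987_claim_juxtaposition_holds`). Size L (paper) / XL (Lean); research risk low. -/
theorem stub_mergeConiveau : MergeConiveau := by
  sorry

/-- **Stub 5 — (R2) JOIN: Ran's ruled join of two classes of maximal coniveau has submaximal
coniveau.** For admissible `β` on `X^{2k₁+1}ₘ`, `γ` on `X^{2k₂+1}ₘ` with `V(β) ⊆ N^{k₁}`,
`V(γ) ⊆ N^{k₂}`, and `α ∼ β ∗ γ` on `X^{2(k₁+k₂+2)}ₘ`: `V(α) ⊆ N^{k₁+k₂+1}H^{2(k₁+k₂+2)}`. Proof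
route: Shioda's type-II span `X^{2k₁+1}ₘ ⊗ X^{2k₂+1}ₘ ←π— E —φ→ Xⁿₘ` (`E` = the `ℙ¹`-bundle of lines
joining the two disjoint sub-Fermat varieties, `dim E = n − 1`; da Silva Thm 2.2 second summand,
type `(1,1)`, `f(Z₁ ⊗ Z₂) = m Z₁ ∧ Z₂`; Ran 1980 §4 `∗ = p₂₊p₁*`, Prop 4.6/Cor 4.7): `f` carries
`V(β) ⊗ V(γ)` onto `V(β ∗ γ)`; a class supported on `W₁ × W₂` (codim `k₁ + k₂`) has
`φ_*π^*`-image supported on `φ(π⁻¹(W₁ × W₂))`, of dimension `≤ dim E − k₁ − k₂`, i.e. codimension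
`≥ k₁ + k₂ + 1` in `Xⁿₘ` (flat pull-back + `complexGysin_mem_supportedClasses`, exactly the mechanism
of the tree's PROVED `complexGysin_map_mem_algebraicClasses_of_flat` in `FermatJuxtapositionGysin`,
one coniveau index down). With `k₂ = 0` (`γ` a CURVE character, `Claim₁` automatic) this is the
card's `m = 35` reduction `(1,2,16,17,21,22,30,31) = (1,21,22,30,31) ∗ (2,16,17)`. Why it might fail:
as Stub 4 (isotypic identification `(hΦV)` for odd factors; the span `E` is not yet a `ℂ`-scheme of
the tree). Size L / XL; research risk low. -/
theorem stub_joinConiveau : JoinConiveau := by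
  sorry

/-- **Stub 6 — THE ENGINE (open; where the crux's research risk now lives): GHC in Hodge level one
for ODD Fermat varieties.** For `m ≥ 1`, `k ≥ 0` and an admissible character `γ` of `X^{2k+1}ₘ`
(`2k+3` coordinates) of Hodge level one (`|tγ| ∈ {k+1, k+2}` for all units `t`), the eigenline
`V(γ) ⊆ H^{2k+1}(X^{2k+1}ₘ(ℂ); ℂ)` is supported on a subvariety of codimension `k`:
`V(γ) ⊆ Nᵏ H^{2k+1}`. `k = 0` is automatic (`N⁰ = ⊤`); `k = 1` says the level-one CM pieces of
`H³` of the Fermat THREEFOLD are swept out by curves (their part of `J²(X³ₘ)_alg` by Abel–Jacobi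
images of 1-parameter families of curves). This is Grothendieck's amended generalized Hodge
conjecture (Topology 8 (1969)) for the level-one sub-Hodge structures `⨁ₜ V(tγ) ⊂ H^{2k+1}(X,ℚ)`,
hence implied by HC (abelian-variety trick) and not touched by `Barriers/GeneralizedHodgeTrivialReasons`
(level one is honest); it is Ran 1980's target — Thm 3.16 (`k = 1`, under statement `(1.10)ₘ`:
θ-reachability from a Fermat-SURFACE Hodge character, verified `m ≤ 8`) and Thm 4.11 (`m` prime,
under `(1.11)ₘ,ₖ`) — WITHOUT the arithmetic provisos, which FAIL where the crux is open (card census: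
at `m = 35` the piece `V[(1,21,22,30,31)] ⊂ H³(X³₃₅)`, Hodge numbers `12 + 12`, is in no `4+4`
split Ran-reachable on both sides; `θ(surface)∗curve` and `θ∗θ` supplies fall in the trivial parity
class). Known supply: Ran's `θ`-images of algebraic surface characters and cones; Albano–Katz (Trans.
AMS 324 (1991), doi:10.1090/s0002-9947-1991-1024767-6: van Geemen lines, infinitesimal GHC on the
Fermat quintic threefold). NEEDED by the composition only for COMPLEMENTED level-one characters
(those arising by merging two coordinates of, or splitting a curve character off, an even Hodge
character) and, by the lattice census of the sibling cards, only at the bad degrees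
`35, 44, 51, 52, 55, 57, …`; stated uniformly because the statement does not see the degree. Why it
might fail: a level-one CM piece of `H^{2k+1}(X^{2k+1}ₘ)` of coniveau `< k` refutes it (and GHC, and —
via products with CM abelian varieties — HC); no method constructs curves with prescribed Abel–Jacobi
component (Barrier `NormalFunctions`, core risk named by the card). Size: open research. -/
theorem stub_oddLevelOneConiveau : OddLevelOneGHC := by
  sorry

/-! ### Glue proved here, I: elementary arithmetic of characters -/

section Arithmetic

variable {m r : ℕ}

/-- `m·|t γ| = Σ` over the multiset of values. [folklore] -/
private theorem normSum_mul_eq (γ : Fin r → ZMod m) (t : ZMod m) :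
    FermatCharacter.normSum (fun i ↦ t * γ i) = ((univ.val.map γ).map fun x ↦ (t * x).val).sum := by
  rw [FermatCharacter.normSum, Finset.sum_eq_multiset_sum, Multiset.map_map]
  rfl

/-- `Σ γᵢ` over the multiset of values. [folklore] -/
private theorem sum_eq_multiset_sum' (γ : Fin r → ZMod m) : ∑ i, γ i = (univ.val.map γ).sum :=
  Finset.sum_eq_multiset_sum _ _

/-- `⟨a⟩ + ⟨b⟩ = ⟨a + b⟩` or `⟨a + b⟩ + m`. [folklore] -/
private theorem val_add_or [NeZero m] (a b : ZMod m) :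
    a.val + b.val = (a + b).val ∨ a.val + b.val = (a + b).val + m := by
  rw [ZMod.val_add]
  rcases Nat.lt_or_ge (a.val + b.val) m with h | h
  · left; rw [Nat.mod_eq_of_lt h]
  · right
    have ha := ZMod.val_lt a
    have hb := ZMod.val_lt b
    rw [Nat.mod_eq_sub_mod h, Nat.mod_eq_of_lt (by omega)]
    omega

/-- An admissible CURVE character has `|c| ∈ {1, 2}`: `m |c| = ⟨c₀⟩ + ⟨c₁⟩ + ⟨c₂⟩ ∈ {m, 2m}`
(three residues in `[1, m-1]` summing to `0 mod m`). [cite: Shioda1979PJA, §1 eq. (2)] -/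
private theorem normSum_three [NeZero m] {c : Fin 3 → ZMod m} (h0 : ∀ i, c i ≠ 0)
    (hsum : ∑ i, c i = 0) :
    FermatCharacter.normSum c = m ∨ FermatCharacter.normSum c = 2 * m := by
  have hdvd : m ∣ FermatCharacter.normSum c := by
    rw [← ZMod.natCast_eq_zero_iff, FermatCharacter.natCast_normSum, hsum]
  have hlo : ∀ i, 1 ≤ (c i).val := fun i ↦
    Nat.one_le_iff_ne_zero.mpr fun h ↦ h0 i ((ZMod.val_eq_zero (c i)).mp h)
  have hhi : ∀ i, (c i).val < m := fun i ↦ ZMod.val_lt _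
  have hN : FermatCharacter.normSum c = (c 0).val + (c 1).val + (c 2).val := by
    rw [FermatCharacter.normSum, Fin.sum_univ_three]
  obtain ⟨q, hq⟩ := hdvd
  have h0' := hlo 0; have h1' := hlo 1; have h2' := hlo 2
  have h0'' := hhi 0; have h1'' := hhi 1; have h2'' := hhi 2
  rcases Nat.lt_or_ge q 3 with hq3 | hq3
  · interval_cases q
    · omega
    · left; omega
    · right; omega
  · exfalso
    have : m * 3 ≤ m * q := Nat.mul_le_mul_left m hq3
    omega

end Arithmetic

/-! ### Glue proved here, II: the pieces split off an even Hodge character are level one -/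

section LevelOne

variable {m : ℕ} [NeZero m]

/-- **Merging two coordinates of an even Hodge character gives a level-one odd character.** If
`α ∈ 𝔅` on `X^{2p+2}ₘ` (`|tα| = p + 2` for all units), `αᵢ + αⱼ ≠ 0`, and `β` realises the merge
(`{α} + {αᵢ+αⱼ} = {β} + {αᵢ, αⱼ}`), then `β` is admissible with `|tβ| ∈ {p+1, p+2}`:
`⟨tαᵢ⟩ + ⟨tαⱼ⟩ − ⟨t(αᵢ+αⱼ)⟩ ∈ {0, m}`. (Ran 1980 §1/§3: the `θ`-preimages of Hodge characters are
the level-one characters of statement `(1.10)ₘ`.) [cite: Ran1980, §1 statements (1.10)–(1.11) and Prop. 1.7] -/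
theorem levelOne_of_merge {p : ℕ} {α : Fin (2 * (p + 1) + 2) → ZMod m}
    (hα : FermatCharacter.IsHodge α) {i j : Fin (2 * (p + 1) + 2)} (hs : α i + α j ≠ 0)
    {β : Fin (2 * p + 1 + 2) → ZMod m}
    (hS : univ.val.map α + {α i + α j} = univ.val.map β + {α i, α j}) :
    LevelOne[m, p, β] := by
  refine ⟨⟨fun l ↦ ?_, ?_⟩, fun t ↦ ?_⟩
  · -- every value of `β` is a value of `α` or the merged value
    have hl : β l ∈ univ.val.map β := Multiset.mem_map.mpr ⟨l, Finset.mem_univ_val l, rfl⟩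
    have hl' : β l ∈ univ.val.map α + {α i + α j} := by
      rw [hS]; exact Multiset.mem_add.mpr (Or.inl hl)
    rcases Multiset.mem_add.mp hl' with h | h
    · obtain ⟨l', -, hl'⟩ := Multiset.mem_map.mp h
      rw [← hl']; exact hα.1.1 l'
    · rw [Multiset.mem_singleton] at h; rw [h]; exact hs
  · -- `Σ βₗ = Σ αₗ + (αᵢ + αⱼ) - αᵢ - αⱼ = 0`
    have h := congrArg Multiset.sum hS
    simp only [Multiset.sum_add, Multiset.sum_singleton, Multiset.insert_eq_cons, Multiset.sum_cons]
      at h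
    rw [← sum_eq_multiset_sum', ← sum_eq_multiset_sum', hα.1.2] at h
    linear_combination -h
  · -- `m|tβ| = m(p+2) + ⟨t(αᵢ+αⱼ)⟩ - ⟨tαᵢ⟩ - ⟨tαⱼ⟩`
    have h := congrArg (fun S : Multiset (ZMod m) ↦ (S.map fun x ↦ ((t : ZMod m) * x).val).sum) hS
    simp only [Multiset.map_add, Multiset.sum_add, Multiset.map_singleton, Multiset.sum_singleton,
      Multiset.insert_eq_cons, Multiset.map_cons, Multiset.sum_cons] at h
    rw [← normSum_mul_eq α, ← normSum_mul_eq β] at h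
    have hA : FermatCharacter.normSum (fun l ↦ (t : ZMod m) * α l) = m * (p + 2) := by
      have h2 := hα.2 t
      have e : m * (2 * (p + 1) + 2) = 2 * (m * (p + 2)) := by ring
      omega
    have e₁ : m * (p + 2) = m * (p + 1) + m := by ring
    have hv := val_add_or ((t : ZMod m) * α i) ((t : ZMod m) * α j)
    rw [← mul_add] at hv
    rcases hv with hv | hv
    · right; omega
    · left; omega

/-- **Splitting a curve character off an even Hodge character leaves a level-one odd character.**
If `α ∈ 𝔅` on `X^{2k+4}ₘ` has the multiset of values of `β` (on `X^{2k+1}ₘ`) plus that of an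
admissible curve character `c` (`α ∼ β ∗ c`), then `β` is admissible with `|tβ| = |tα| − |tc| ∈
{k+1, k+2}` since `|tc| ∈ {1, 2}`. [cite: Ran1980, §1 Prop. 1.7 and §4 Cor. 4.7] -/
theorem levelOne_of_join {k : ℕ} {α : Fin (2 * (k + 1 + 1) + 2) → ZMod m}
    (hα : FermatCharacter.IsHodge α) {β : Fin (2 * k + 1 + 2) → ZMod m} {c : Fin 3 → ZMod m}
    (hc : FermatCharacter.IsAdmissible c) (hS : univ.val.map α = univ.val.map β + univ.val.map c) :
    LevelOne[m, k, β] := by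
  refine ⟨⟨fun l ↦ ?_, ?_⟩, fun t ↦ ?_⟩
  · have hl : β l ∈ univ.val.map α := by
      rw [hS]; exact Multiset.mem_add.mpr (Or.inl (Multiset.mem_map.mpr ⟨l, Finset.mem_univ_val l, rfl⟩))
    obtain ⟨l', -, hl'⟩ := Multiset.mem_map.mp hl
    rw [← hl']; exact hα.1.1 l'
  · have h := congrArg Multiset.sum hS
    rw [Multiset.sum_add, ← sum_eq_multiset_sum', ← sum_eq_multiset_sum', ← sum_eq_multiset_sum',
      hα.1.2, hc.2] at h
    linear_combination -h
  · have h := congrArg (fun S : Multiset (ZMod m) ↦ (S.map fun x ↦ ((t : ZMod m) * x).val).sum) hS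
    simp only [Multiset.map_add, Multiset.sum_add] at h
    rw [← normSum_mul_eq α, ← normSum_mul_eq β, ← normSum_mul_eq c] at h
    have hA : FermatCharacter.normSum (fun l ↦ (t : ZMod m) * α l) = m * (k + 3) := by
      have h2 := hα.2 t
      have e : m * (2 * (k + 1 + 1) + 2) = 2 * (m * (k + 3)) := by ring
      omega
    have hC := normSum_three (c := fun l ↦ (t : ZMod m) * c l)
      (fun l ↦ (Units.mul_right_eq_zero t).not.mpr (hc.1 l))
      (by rw [← Finset.mul_sum, hc.2, mul_zero])
    have e₁ : m * (k + 3) = m * (k + 2) + m := by ring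
    have e₂ : m * (k + 2) = m * (k + 1) + m := by ring
    rcases hC with hC | hC
    · right; omega
    · left; omega

omit [NeZero m] in
/-- **An admissible character all of whose pairs of coordinates are opposite is paired** (it is
`(a, …, a)` with `2a = 0`, on `≥ 4` coordinates; `m` even). [folklore] -/
theorem isPaired_of_forall_add_eq_zero {p : ℕ} {α : Fin (2 * (p + 1) + 2) → ZMod m}
    (h : ∀ i j, i ≠ j → α i + α j = 0) : FermatCharacter.IsPaired α := by
  -- any two indices admit a third one
  have third : ∀ i j : Fin (2 * (p + 1) + 2), ∃ l, l ≠ i ∧ l ≠ j := by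
    intro i j
    by_contra hc
    push Not at hc
    have hsub : (Finset.univ : Finset (Fin (2 * (p + 1) + 2))) ⊆ {i, j} := by
      intro l _
      rw [Finset.mem_insert, Finset.mem_singleton]
      by_cases hli : l = i
      · exact Or.inl hli
      · exact Or.inr (hc l hli)
    have hcard := Finset.card_le_card hsub
    rw [Finset.card_univ, Fintype.card_fin] at hcard
    have := Finset.card_le_two (a := i) (b := j)
    omega
  refine FermatCharacter.isPaired_of_forall_eq_neg ⟨p + 2, by ring⟩ (fun i j ↦ ?_) fun i ↦ ?_
  · by_cases hij : i = j
    · rw [hij]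
    · obtain ⟨l, hli, hlj⟩ := third i j
      have h1 := h i l (Ne.symm hli)
      have h2 := h j l (Ne.symm hlj)
      linear_combination h1 - h2
  · obtain ⟨j, hji, -⟩ := third i i
    obtain ⟨l, hli, hlj⟩ := third i j
    have h1 := h i j (Ne.symm hji)
    have h2 := h j l (Ne.symm hlj)
    have h3 := h i l (Ne.symm hli)
    linear_combination h1 - h2 + h3

end LevelOne

/-! ### Glue proved here, III: the calculus — every Hodge eigenline of `X^{2p+2}ₘ` is submaximal -/

section Calculus

variable {m : ℕ} [NeZero m]

/-- **The parity-graded claim calculus, assembled (sorry-free): granted the paired supply, the two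
transport rules and the engine, `V(α) ⊆ Nᵖ H^{2p+2}(X^{2p+2}ₘ)` for EVERY Hodge character `α`.**
Dispatch: (1) if `α ∼ β ∗ c` with `c` an admissible CURVE character (so `p = k + 1`), `β` is a
level-one character of `X^{2k+1}ₘ` (`levelOne_of_join`), the engine gives `Claim₁ β`, the curve
factor has `Claim₁` for free (`N⁰ = ⊤`), and the JOIN rule (R2) concludes — at `m = 35` this is the
card's reduction of the parity class to `V[(1,21,22,30,31)] ⊆ N¹H³(X³₃₅)`; (2) else, if some
`αᵢ + αⱼ ≠ 0`, every realisation of the MERGE is level one (`levelOne_of_merge`), the engine feeds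
the MERGE rule (R1/θ); (3) else all pairs are opposite, `α` is paired
(`isPaired_of_forall_add_eq_zero`) and `V(α) ⊆ N^{p+1} ⊆ Nᵖ` by the linear subspaces
(`Shioda_claim_paired`). [cite: Ran1980, Thm. 3.16, Thm. 4.11 and Cor. 4.7]
[cite: daSilva2021HodgeFermat, Thm. 2.2 and Cor. 2.3] [cite: Aoki1987, Thm. 1-1 and Thm. 1-4] -/
theorem submax_of_isHodge (hP : Shioda_claim_paired) (hM : MergeConiveau) (hJ : JoinConiveau)
    (hEm : ∀ (k : ℕ) (γ : Fin (2 * k + 1 + 2) → ZMod m), LevelOne[m, k, γ] → Claim₁[m, k, γ])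
    {p : ℕ} {α : Fin (2 * (p + 1) + 2) → ZMod m}
    (hα : FermatCharacter.IsHodge α) : Submax[m, p, α] := by
  classical
  -- Case 1 (R2): `α ∼ β ∗ c` with `c` an admissible curve character (only possible for `p = k + 1`)
  by_cases h1 : ∃ (k : ℕ) (_ : p = k + 1) (β : Fin (2 * k + 1 + 2) → ZMod m) (c : Fin 3 → ZMod m),
      FermatCharacter.IsAdmissible c ∧ univ.val.map α = univ.val.map β + univ.val.map c
  · obtain ⟨k, rfl, β, c, hc, hS⟩ := h1
    have hL := levelOne_of_join hα hc hS
    have hc₁ : Claim₁[m, 0, c] := by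
      rw [supportedClasses_zero]; exact le_top
    exact hJ m k 0 β c α hL.1 hc hS (hEm k β hL) hc₁
  -- Case 2 (R1/θ): some pair of coordinates is not opposite — merge it
  by_cases h2 : ∃ i j : Fin (2 * (p + 1) + 2), i ≠ j ∧ α i + α j ≠ 0
  · obtain ⟨i, j, hij, hs⟩ := h2
    exact hM m p α i j hij hα.1 hs fun β _ hS ↦ hEm p β (levelOne_of_merge hα hs hS)
  -- Case 3: all pairs are opposite — `α` is paired, `V(α)` is spanned by linear subspaces
  · push Not at h2
    have hpaired : FermatCharacter.IsPaired α :=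
      isPaired_of_forall_add_eq_zero fun i j hij ↦ h2 i j hij
    exact (hP m (p + 1) α hα.1.1 hpaired).trans (supportedClasses_mono _ _ (Nat.le_succ p))

end Calculus

/-! ### Glue proved here, IV: middle degree, standard model, and the crux -/

section Assembly

variable {m : ℕ}

/-- **The middle degree of `X^{2p+2}ₘ` from submaximality of the Hodge eigenlines** (the tree's
`mem_algebraicClasses_fermat_middle_of_eigenspaces`, one coniveau step down): a rational
`(p+1,p+1)`-class `c = Σ_α π_α c` has `π_0 c` restricted from `ℙ` (algebraic, hence in `Nᵖ`),
`π_α c = 0` for `α ≠ 0` with a zero entry, and `π_α c ∈ V(α) ⊆ Nᵖ` for the remaining `α`, which are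
Hodge characters (`FermatCharacter.isHodge_of_fermatProjector_ne_zero`, the `ℚ`-structure); so
`c ∈ Nᵖ H^{2p+2}` is RATIONAL of type `(p+1,p+1)`, hence algebraic by `SubmaximalConiveau`.
[cite: Ran1980, Thm. 4.9 and §1 Prop. 1.7] [cite: Voisin2013GHCBloch, Lemma 2.1 (proof)] -/
theorem middleDegree_of_submax [NeZero m] (hES : EigenStructure) (hV : SubmaximalConiveau) {p : ℕ}
    (hB : ∀ α : Fin (2 * (p + 1) + 2) → ZMod m, FermatCharacter.IsHodge α → Submax[m, p, α]) :
    ∀ c : complexBetti (fermatHypersurface (2 * (p + 1)) m) (2 * (p + 1)), IsRationalClass c →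
      IsOfHodgeType (2 * (p + 1)) (fermatHypersurface (2 * (p + 1)) m) (2 * (p + 1)) (p + 1) (p + 1) c →
        c ∈ algebraicClasses (fermatHypersurface (2 * (p + 1)) m) (p + 1) := by
  intro c hc hpp
  obtain ⟨hE2, hE0, hE4⟩ := hES (p + 1) m (Nat.succ_pos p)
  have hX : IsSmoothProjective (2 * (p + 1)) (fermatHypersurface (2 * (p + 1)) m) :=
    isSmoothProjective_fermatHypersurface (by omega) NeZero.one_le
  obtain ⟨A, hA⟩ := id hpp
  -- every eigencomponent of `c` is submaximal, hence so is `c`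
  have hcN : c ∈ supportedClasses (fermatHypersurface (2 * (p + 1)) m) (2 * (p + 1)) p := by
    rw [← sum_fermatProjector c]
    refine Submodule.sum_mem _ fun α _ ↦ ?_
    by_cases hα0 : fermatProjector m α (2 * (p + 1)) c = 0
    · rw [hα0]; exact Submodule.zero_mem _
    have hmem : fermatProjector m α (2 * (p + 1)) c ∈ fermatEigenspace m α (2 * (p + 1)) :=
      fermatProjector_mem α c
    by_cases hzero : α = 0
    · subst hzero
      exact supportedClasses_mono _ _ (Nat.le_succ p)
        (range_map_projectiveSpace_le_algebraicClasses hX _ (p + 1) (hE0 hmem))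
    by_cases hsome : ∃ i, α i = 0
    · exact absurd ((Submodule.eq_bot_iff _).mp (hE2 α hzero hsome) _ hmem) hα0
    push Not at hsome
    exact hB α (FermatCharacter.isHodge_of_fermatProjector_ne_zero (Nat.succ_pos p) hE4 hc hA hsome hα0)
      hmem
  exact hV hX p c hcN hc hpp

/-- **HC for the standard model `V₊(Σ xᵢᵐ) ⊂ ℙⁿ⁺¹` of a FIXED degree `m ≥ 1`, `n ≥ 1`, from Lefschetz
off the middle degree, Hodge models, and the middle degrees `2(p+1)` at that degree** (`n = 2·0` is
excluded by `n ≥ 1`). [cite: Shioda1979PJA, §2 (p. 112), the sentence preceding Thm. 1] -/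
theorem standardModelHC (hLef : Voisin2003_smoothHypersurface_algebraicClasses_eq_top)
    (hHM : ∀ (n : ℕ) (X : SchemeOver ℂ), nonempty_hodgeModel n X) [NeZero m]
    (hmid : ∀ (p : ℕ) (c : complexBetti (fermatHypersurface (2 * (p + 1)) m) (2 * (p + 1))),
      IsRationalClass c →
        IsOfHodgeType (2 * (p + 1)) (fermatHypersurface (2 * (p + 1)) m) (2 * (p + 1)) (p + 1) (p + 1) c →
          c ∈ algebraicClasses (fermatHypersurface (2 * (p + 1)) m) (p + 1))
    {n : ℕ} (hn : 1 ≤ n) : HodgeConjectureFor n (fermatHypersurface n m) := by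
  have hm : 1 ≤ m := NeZero.one_le
  have hX : IsSmoothProjective n (fermatHypersurface n m) := isSmoothProjective_fermatHypersurface hn hm
  refine ⟨hHM n _ hX, fun q c hc hqq ↦ ?_⟩
  by_cases h2 : 2 * q = n
  · subst h2
    cases q with
    | zero => exact absurd hn (by omega)
    | succ p => exact hmid p c hc hqq
  · rw [algebraicClasses_fermat_eq_top_of_two_mul_ne hLef hX (isFermatVariety_fermatHypersurface hm)
      hm h2]
    exact Submodule.mem_top

/-- **`HodgeConjectureFor` transports along isomorphisms of smooth projective `ℂ`-schemes** (verbatim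
the disprover's `Disproof.hodgeConjectureFor_of_iso`, §4, re-proved because Cruxes files are not
importable: `HodgeModel.ofIso`, `IsOfHodgeType.map_of_iso`, `mem_algebraicClasses_map_of_iso`).
[cite: Hartshorne1977, II Ex. 3.11 (d)] -/
theorem hodgeConjectureFor_of_iso {n : ℕ} {X S : SchemeOver ℂ} (hS : IsSmoothProjective n S)
    (hX : IsSmoothProjective n X) (e : X ≅ S) (h : HodgeConjectureFor n S) :
    HodgeConjectureFor n X := by
  obtain ⟨⟨A⟩, hcyc⟩ := h
  refine ⟨⟨A.ofIso e⟩, fun p c hc hpp ↦ ?_⟩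
  set c' : complexBetti S (2 * p) :=
    singularCohomology.map ℂ ℂ (Motives.AlgPoints.mapContinuous (L := ℂ) e.inv) (2 * p) c with hc'
  have hc'rat : IsRationalClass c' := hc.map _
  have hc'pp : IsOfHodgeType n S (2 * p) p p c' := hpp.map_of_iso e.symm
  have halg := mem_algebraicClasses_map_of_iso hS hX e (hcyc p c' hc'rat hc'pp)
  rwa [hc', show complexBetti.map e.hom (2 * p)
      (singularCohomology.map ℂ ℂ (Motives.AlgPoints.mapContinuous (L := ℂ) e.inv) (2 * p) c) = c from
    map_hom_map_inv_apply e (2 * p) c] at halg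

/-- **Every Fermat variety of a FIXED degree `m ≥ 1` from the standard models of that degree**:
`n = 0` is a point (`H²ᵖ` is algebraic for `p = 0` and zero above), and for `n ≥ 1` every Fermat
variety is `ℂ`-isomorphic to `V₊(Σ xᵢᵐ)` (`IsFermatVariety.isoFermatHypersurface`). [folklore] -/
theorem hodgeConjectureFor_fermat_of_standardModel [NeZero m]
    (hHM : ∀ (n : ℕ) (X : SchemeOver ℂ), nonempty_hodgeModel n X)
    (hSM : ∀ n : ℕ, 1 ≤ n → HodgeConjectureFor n (fermatHypersurface n m)) :
    ∀ (n : ℕ) (X : SchemeOver ℂ), IsFermatVariety n m X → IsSmoothProjective n X →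
      HodgeConjectureFor n X := by
  intro n X hF hX
  rcases Nat.eq_zero_or_pos n with rfl | hn
  · exact ⟨hHM 0 X hX, fun p c _ _ ↦ by
      rw [algebraicClasses_eq_top_of_eq_zero_or_le hX (Or.inr (Nat.zero_le p))]
      exact Submodule.mem_top⟩
  · exact hodgeConjectureFor_of_iso (isSmoothProjective_fermatHypersurface hn NeZero.one_le) hX
      hF.isoFermatHypersurface (hSM n hn)

/-- **The crux from the standard models**: `m = 0` is vacuous (landed Negative lemma
`degree_zero_vacuous`: `V₊(unit) = ∅` against geometric irreducibility); `m ≥ 1` is the previous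
theorem. [folklore] -/
theorem hodgeFermatVarieties_of_standardModel
    (hHM : ∀ (n : ℕ) (X : SchemeOver ℂ), nonempty_hodgeModel n X)
    (hSM : ∀ n m : ℕ, 1 ≤ n → 1 ≤ m → HodgeConjectureFor n (fermatHypersurface n m)) :
    HodgeFermatVarieties := by
  intro n m X hF hX
  rcases Nat.eq_zero_or_pos m with rfl | hm
  · exact (degree_zero_vacuous hF hX).elim
  · haveI : NeZero m := ⟨by omega⟩
    exact hodgeConjectureFor_fermat_of_standardModel hHM (fun n hn ↦ hSM n m hn hm) n X hF hX

end Assembly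

/-! ### Per-degree form for the provers: the engine AT ONE DEGREE closes that degree -/

/-- **HC for every Fermat variety of a fixed degree `m ≥ 1` from the structural stubs and the engine
AT DEGREE `m` ONLY.** Granted stubs 1–5 (facts, eigenspace structure, Voisin's lemma, merge, join),
if every level-one character `γ` of every ODD Fermat variety `X^{2k+1}ₘ` OF THIS DEGREE has
`Claim₁` (`V(γ) ⊆ Nᵏ H^{2k+1}`), then `HodgeConjectureFor n X` holds for every smooth projective
Fermat variety `X` of degree `m` and every `n`. This is the form in which the card's census is used:
at `m = 35` (hence `70, 105, 140` by pull-back, sibling card primitive-gap-descent) the lattice line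
leaves ONE parity class, reached by the join rule from `V[(1,21,22,30,31)] ⊆ N¹H³(X³₃₅)`.
[cite: Ran1980, Thm. 3.16 and Thm. 4.11] [cite: daSilva2021HodgeFermat, Thm. 2.2] -/
theorem hodgeConjectureFor_of_engineAt
    (hF : Voisin2003_smoothHypersurface_algebraicClasses_eq_top ∧
      (∀ (n : ℕ) (X : SchemeOver ℂ), nonempty_hodgeModel n X) ∧ Shioda_claim_paired)
    (hES : EigenStructure) (hV : SubmaximalConiveau) (hM : MergeConiveau) (hJ : JoinConiveau)
    {m : ℕ} [NeZero m]
    (hEm : ∀ (k : ℕ) (γ : Fin (2 * k + 1 + 2) → ZMod m), LevelOne[m, k, γ] → Claim₁[m, k, γ]) :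
    ∀ (n : ℕ) (X : SchemeOver ℂ), IsFermatVariety n m X → IsSmoothProjective n X →
      HodgeConjectureFor n X :=
  hodgeConjectureFor_fermat_of_standardModel hF.2.1 fun _ hn ↦
    standardModelHC hF.1 hF.2.1
      (fun _ ↦ middleDegree_of_submax hES hV fun _ hα ↦ submax_of_isHodge hF.2.2 hM hJ hEm hα) hn

/-! ### The composition: the six stubs imply the crux, by name -/

/-- `LineImplication` — THE SHAPE OF THE LINE as one proposition: stub 1 → … → stub 6 →
`HodgeFermatVarieties`, the statements of the six stubs spelled out verbatim (so that
`lineImplication` is a sorry-free, kernel-checked certificate that the registered stub STATEMENTS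
compose into the crux, and `HodgeFermatVarieties_of` is literally
`lineImplication stub_fermatFacts … stub_oddLevelOneConiveau`). -/
abbrev LineImplication : Prop :=
  (Voisin2003_smoothHypersurface_algebraicClasses_eq_top ∧
      (∀ (n : ℕ) (X : SchemeOver ℂ), nonempty_hodgeModel n X) ∧ Shioda_claim_paired) →
    EigenStructure → SubmaximalConiveau → MergeConiveau → JoinConiveau → OddLevelOneGHC →
      Summit.HodgeConjecture.HodgeConjecture.Theses.PadicSemiregularLift.HodgeFermatVarieties

/-- **The six stub statements imply the crux** (sorry-free): Lefschetz off the middle degree, Hodge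
models and the `m = 0` / `n = 0` / standard-model bookkeeping reduce the crux to the middle degree of
`X^{2p+2}ₘ` (`hodgeFermatVarieties_of_standardModel`, `standardModelHC`); there a rational
`(p+1,p+1)`-class is algebraic as soon as every Hodge eigenline is submaximal (eigenspace structure +
Voisin's lemma, `middleDegree_of_submax`); and the calculus (`submax_of_isHodge`: join, merge, paired
supply, fed by the level-one engine) makes every Hodge eigenline submaximal. [folklore assembly] -/
theorem lineImplication : LineImplication := by
  intro hF hES hV hM hJ hE n m X hFX hX
  rcases Nat.eq_zero_or_pos m with rfl | hm
  · exact (degree_zero_vacuous hFX hX).elim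
  · haveI : NeZero m := ⟨by omega⟩
    exact hodgeConjectureFor_of_engineAt hF hES hV hM hJ (fun k γ ↦ hE m k γ) n X hFX hX

/-- **`HodgeFermatVarieties_of` — the crux BY NAME from the six registered stubs** (the only `sorry`s
of the file live inside `stub_*`; this composition and `lineImplication` are sorry-free). -/
theorem HodgeFermatVarieties_of :
    Summit.HodgeConjecture.HodgeConjecture.Theses.PadicSemiregularLift.HodgeFermatVarieties :=
  lineImplication stub_fermatFacts stub_eigenspaceStructure stub_submaximalConiveau
    stub_mergeConiveau stub_joinConiveau stub_oddLevelOneConiveau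

end Summit.HodgeConjecture.HodgeConjecture.Cruxes.HodgeFermatVarieties.OddConiveauCalculus

end
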